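import Mathlib
import Literature.Computability.Complexity.CircuitClasses
import Literature.Computability.Complexity.ConstantDepth
import Literature.Computability.MetaComplexity.FormulaModelsAE
import Literature.Computability.MetaComplexity.OliveiraSanthanam2018.ApproxMCSPAC0Magnification
import Literature.Computability.MetaComplexity.ChenJinWilliams2019.SparseMagnification
import Literature.Computability.MetaComplexity.ChenJinWilliams2019.SparseFormulaMagnification
import HarnessLib

/-!
# Chen–Jin–Williams 2019, Theorem 1.1 items 6–7 (`C = NP`): sparse `NP` languages vs
# `AC_{d+2}[m][n^{1+ε}]` (m even) and `TC_{d+O(log 1/ε)}[n^{1+ε}]` (wires), as named facts —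
# census cell `pub-magnif`, row R49 (the DEPTH-gap rows; NO converse in print)

Citation header. L. Chen, C. Jin, R. R. Williams, *Hardness Magnification for all Sparse NP
Languages*, FOCS 2019, doi:10.1109/FOCS.2019.00077 [bib: `ChenJinWilliams2019`]; full version ECCC
TR19-118 (held key `paper:url-5c604605311c`). Printed (TR19-118 p. 3 L17–19 and p. 4 L3–5,
verbatim): *"We also consider constant-depth circuit classes of unbounded fan-in, such as AC_d[m][s]
(circuits of size s(n) and depth d over AND, OR, NOT, and MOD_m gates) and TC_d[s] (threshold
circuits of size s(n) and depth d). We measure the size of AC_d[m] circuits by number of gates, and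
the size of TC_d circuits by number of wires."* — *"[Theorem 1.1 … L_β is a 2^{n^β}-sparse language in
C and for all β:] 6. L_β ∉ AC_{d+2}[m][n^{1+ε}], then C ⊄ AC_d[m][n^k] for all k, for all constants d
and even integers m ≥ 2. 7. L_β ∉ TC_{d+O(log 1/ε)}[n^{1+ε}], then C ⊄ TC_d[n^k] for all k, for all
constants d. Moreover, the converse of each item above also holds, except for the last two."* Proof in
print: §4.1 p. 15 ("The AC⁰[m] case": XOR layer simulated by `MOD_m` gates, `m` even, `+2` levels;
"The threshold circuit (TC⁰) case": the Chen–Tell code `E` computable in depth `d'+2` with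
`n^{1+c₀φ^{−d'}+o(1)}` wires, `d' = O(log 1/ε)`).

## Rendering (each choice makes the vendored implication a consequence of the printed one)

* `AC_d[m][M]` ↦ `ACdModSIZEae m d M`: the almost-everywhere `FamilyAE` class of circuits over the
  tree's `accBasis m` (`∧ₖ, ∨ₖ, ¬, MOD_m` of every arity) with `acDepth ≤ d` (negations weightless,
  the standard convention) and `Circuit.size ≤ M n` GATES — the `MOD_m` twin of
  `OliveiraSanthanam2018.ACdSIZEae`. Our gate count includes `¬` gates (print's negations are free
  literals): a printed circuit of `s` gates is one of ours with `≤ s + n` gates, absorbed by the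
  `ε/2` slack (`n^{1+ε/2} + n ≤ ⌈n^{1+ε}⌉` for large `n`); the a.e. class contains the every-length
  printed class; so `L ∉ ACdModSIZEae m (d+2) ⌈n^{1+ε}⌉` implies the printed hypothesis at `ε/2`,
  and the printed conclusion at `k+1` (read asymptotically, cf. `SparseFormulaMagnification`) gives
  ours at `k` (`n^k + n ≤ n^{k+1}`).
* `TC_d[s]` (wires) ↦ `TCdWIRESae d s`: `FamilyAE` over the basis `ltfBasis` of INTEGER-WEIGHT
  LINEAR THRESHOLD gates (every real-weight threshold gate on finitely many Boolean inputs has an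
  integer realisation; `¬`, `∧ₖ`, `∨ₖ`, `MAJₖ` are LTFs), `acDepth ≤ d` (so `¬` gates, if used, are
  depth-free — generous: the class only grows) and `Circuit.wires ≤ s n`, where `Circuit.wires` =
  total fan-in = number of wires. Negated literals cost one `¬` gate + wire in our count (`≤ 2s + n`
  for a printed `s`-wire circuit), again absorbed by `ε/2`; conversely a `¬` on top of an LTF gate is
  an LTF gate, so our circuits are printed ones up to duplicating gates used in both polarities
  (`≤ 2×` wires, absorbed by `k ↦ k+1`).
* "`d + O(log 1/ε)`" ↦ `d + c₀ · (⌈log₂(1/ε)⌉₊ + 1)` with the absolute constant `c₀` EXISTENTIALLY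
  quantified outermost (`thm11_item7_NP : ∃ c₀, ∀ d ε …`), `ε ∈ (0,1)`; the `+1` covers `ε` near `1`
  and the `ε ↦ ε/2` bookkeeping (`log₂(2/ε) ≤ ⌈log₂(1/ε)⌉ + 1`).
* HONEST FRAMING (census rule): both facts are THRESHOLD facts (T) WITHOUT converse ("except for
  the last two"): R49 is a genuine DEPTH gap (`d+2 → d`, `d+O(log 1/ε) → d`) on top of the size gap
  `n^{1+ε}` vs the known `n^{1+c^{−d}}`-wire bounds for DENSE functions (Impagliazzo–Paturi–Saks 1997,
  Chen–Tell 2019; census R44, not vendored here). The hypotheses are OPEN, recorded as `Prop`s.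

## What is proved here (elementary)

`Circuit.wires`/`ltfBasis` basics (`¬`, `∧ₖ`, `∨ₖ`, `MAJₖ` are LTF gates, so `tcBasis ⊆ ltfBasis`
and `acBasis ⊆ ltfBasis`), inhabitedness of every class involved (`headLang`), antitonicity in `ε`
of the item-6 hypothesis.
-/

noncomputable section

namespace Literature.Computability.MetaComplexity.ChenJinWilliams2019

open Finset
open Literature.Computability.Complexity Literature.Computability.Complexity.Nondeterministic
open Literature.Computability.MetaComplexity

/-! ### Wires and linear threshold gates -/

/-- The number of WIRES of a circuit: the total fan-in over all gates (Jukna 2012, §1.2; the size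
measure of `TC_d` in Chen–Jin–Williams 2019 / Chen–Tell 2019). [cite: ChenJinWilliams2019, §1.1
(Notation: "the size of TC_d circuits by number of wires")] -/
def _root_.Literature.Computability.Complexity.Circuit.wires {ι : Type*} (C : Circuit ι) : ℕ :=
  (C.gates.map Gate.arity).sum

/-- The input circuit has no wires. [folklore] -/
@[simp] theorem wires_input {n : ℕ} (i : Fin n) : (Circuit.input i).wires = 0 := rfl

/-- A gate function is a LINEAR THRESHOLD gate: `f(x) = [θ ≤ Σᵢ wᵢ xᵢ]` for integer weights and
threshold (real weights on Boolean inputs can always be replaced by integers).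
[cite: ChenJinWilliams2019, §1.1 (Notation: threshold circuits)] -/
def _root_.Literature.Computability.Complexity.GateFn.IsLTF (f : GateFn) : Prop :=
  ∃ (w : Fin f.1 → ℤ) (θ : ℤ), ∀ x : Fin f.1 → Bool, f.2 x = decide (θ ≤ ∑ i, if x i then w i else 0)

/-- The basis of all linear threshold gates. [cite: ChenJinWilliams2019, §1.1 (Notation: TC_d)] -/
def ltfBasis : Set GateFn := {f | f.IsLTF}

/-- `¬` is a threshold gate (`w = −1`, `θ = 0`). [folklore] -/
theorem isLTF_not : GateFn.not.IsLTF := by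
  change GateFn.IsLTF ⟨1, fun v => !(v 0)⟩
  refine ⟨fun _ => -1, 0, fun x => ?_⟩
  change (!(x 0)) = _
  cases h : x 0 <;> simp [h]

/-- `Σᵢ [xᵢ]·1 = numOnes x`. [folklore] -/
theorem sum_ite_one_eq_numOnes {k : ℕ} (x : Fin k → Bool) :
    (∑ i, if x i then (1 : ℤ) else 0) = (GateFn.numOnes x : ℤ) := by
  unfold GateFn.numOnes
  rw [Finset.sum_ite, Finset.sum_const_zero, add_zero, Finset.sum_const]
  simp

/-- `∧ₖ` is a threshold gate (`w = 1`, `θ = k`). [folklore] -/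
theorem isLTF_and (k : ℕ) : (GateFn.and k).IsLTF := by
  change GateFn.IsLTF ⟨k, fun v => decide (∀ i, v i = true)⟩
  refine ⟨fun _ => 1, k, fun x => ?_⟩
  change decide (∀ i, x i = true) = _
  rw [sum_ite_one_eq_numOnes]
  unfold GateFn.numOnes
  by_cases h : ∀ i, x i = true
  · rw [decide_eq_true h]
    symm; apply decide_eq_true
    have : (univ.filter fun i => x i = true) = (univ : Finset (Fin k)) :=
      Finset.filter_true_of_mem fun i _ => h i
    rw [this, Finset.card_univ, Fintype.card_fin]
  · rw [decide_eq_false h]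
    symm; apply decide_eq_false
    push Not at h
    obtain ⟨i, hi⟩ := h
    have hlt : (univ.filter fun j => x j = true).card < k := by
      calc (univ.filter fun j => x j = true).card
          < (univ : Finset (Fin k)).card :=
            Finset.card_lt_card (Finset.filter_ssubset.2 ⟨i, Finset.mem_univ _, hi⟩)
        _ = k := by rw [Finset.card_univ, Fintype.card_fin]
    omega

/-- `∨ₖ` is a threshold gate (`w = 1`, `θ = 1`). [folklore] -/
theorem isLTF_or (k : ℕ) : (GateFn.or k).IsLTF := by
  change GateFn.IsLTF ⟨k, fun v => decide (∃ i, v i = true)⟩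
  refine ⟨fun _ => 1, 1, fun x => ?_⟩
  change decide (∃ i, x i = true) = _
  rw [sum_ite_one_eq_numOnes]
  unfold GateFn.numOnes
  by_cases h : ∃ i, x i = true
  · rw [decide_eq_true h]
    symm; apply decide_eq_true
    obtain ⟨i, hi⟩ := h
    have : 0 < (univ.filter fun j => x j = true).card :=
      Finset.card_pos.2 ⟨i, Finset.mem_filter.2 ⟨Finset.mem_univ _, hi⟩⟩
    omega
  · rw [decide_eq_false h]
    symm; apply decide_eq_false
    push Not at h
    have : (univ.filter fun j => x j = true) = (∅ : Finset (Fin k)) :=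
      Finset.filter_false_of_mem fun i _ => by simpa using h i
    rw [this, Finset.card_empty]
    omega

/-- `MAJₖ` is a threshold gate (`w = 2`, `θ = k`). [folklore] -/
theorem isLTF_maj (k : ℕ) : (GateFn.maj k).IsLTF := by
  change GateFn.IsLTF ⟨k, fun v => decide (k ≤ 2 * GateFn.numOnes v)⟩
  refine ⟨fun _ => 2, k, fun x => ?_⟩
  change decide (k ≤ 2 * GateFn.numOnes x) = _
  have : (∑ i, if x i then (2 : ℤ) else 0) = 2 * (GateFn.numOnes x : ℤ) := by
    rw [← sum_ite_one_eq_numOnes, Finset.mul_sum]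
    refine Finset.sum_congr rfl fun i _ => ?_
    split_ifs <;> simp
  rw [this]
  by_cases h : k ≤ 2 * GateFn.numOnes x
  · rw [decide_eq_true h, decide_eq_true (by exact_mod_cast h)]
  · rw [decide_eq_false h, decide_eq_false (by exact_mod_cast h)]

/-- The tree's AC basis consists of threshold gates. [folklore] -/
theorem acBasis_subset_ltfBasis : acBasis ⊆ ltfBasis := by
  intro f hf
  rcases hf with hf | hf
  · rw [Set.mem_singleton_iff.1 hf]; exact isLTF_not
  · obtain ⟨k, hk⟩ := Set.mem_iUnion.1 hf
    rcases hk with rfl | hk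
    · exact isLTF_and k
    · rw [Set.mem_singleton_iff.1 hk]; exact isLTF_or k

/-- The tree's majority basis `tcBasis` consists of threshold gates: our `TC_d` (LTF gates) contains
the majority-gate rendering. [folklore] -/
theorem tcBasis_subset_ltfBasis : tcBasis ⊆ ltfBasis := by
  intro f hf
  rcases hf with hf | hf
  · exact acBasis_subset_ltfBasis hf
  · obtain ⟨k, hk⟩ := Set.mem_iUnion.1 hf
    rw [Set.mem_singleton_iff.1 hk]; exact isLTF_maj k

/-! ### The almost-everywhere classes `AC_d[m][M]` (gates) and `TC_d[s]` (wires) -/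

/-- **`AC_d[m][M]`, almost everywhere**: circuit families over `∧, ∨, ¬, MOD_m` (unbounded fan-in)
with `acDepth ≤ d` and at most `M n` gates at every sufficiently large length.
[cite: ChenJinWilliams2019, §1.1 (Notation: AC_d[m][s], size = gates)] -/
def ACdModSIZEae (m d : ℕ) (M : ℕ → ℕ) : Set (Language Bool) :=
  FamilyAE fun n C => C.IsOver (accBasis m) ∧ C.acDepth ≤ d ∧ C.size ≤ M n

/-- **`TC_d[s]`, almost everywhere, size = WIRES**: circuit families over linear threshold gates with
`acDepth ≤ d` and at most `s n` wires at every sufficiently large length.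
[cite: ChenJinWilliams2019, §1.1 (Notation: TC_d[s], size = wires)] -/
def TCdWIRESae (d : ℕ) (s : ℕ → ℕ) : Set (Language Bool) :=
  FamilyAE fun n C => C.IsOver ltfBasis ∧ C.acDepth ≤ d ∧ C.wires ≤ s n

/-- `ACdModSIZEae` is monotone in the (eventual) size bound. [folklore] -/
theorem ACdModSIZEae_mono (m d : ℕ) {M M' : ℕ → ℕ} (h : ∃ n₁ : ℕ, ∀ n ≥ n₁, M n ≤ M' n) :
    ACdModSIZEae m d M ⊆ ACdModSIZEae m d M' := by
  obtain ⟨n₁, hn₁⟩ := h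
  exact FamilyAE_mono ⟨n₁, fun n hn C hC => ⟨hC.1, hC.2.1, hC.2.2.trans (hn₁ n hn)⟩⟩

/-- `ACdModSIZEae` is monotone in the depth. [folklore] -/
theorem ACdModSIZEae_mono_depth (m : ℕ) {d d' : ℕ} (h : d ≤ d') (M : ℕ → ℕ) :
    ACdModSIZEae m d M ⊆ ACdModSIZEae m d' M :=
  FamilyAE_mono ⟨0, fun _ _ _ hC => ⟨hC.1, hC.2.1.trans h, hC.2.2⟩⟩

/-- `TCdWIRESae` is monotone in the (eventual) wire bound. [folklore] -/
theorem TCdWIRESae_mono (d : ℕ) {s s' : ℕ → ℕ} (h : ∃ n₁ : ℕ, ∀ n ≥ n₁, s n ≤ s' n) :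
    TCdWIRESae d s ⊆ TCdWIRESae d s' := by
  obtain ⟨n₁, hn₁⟩ := h
  exact FamilyAE_mono ⟨n₁, fun n hn C hC => ⟨hC.1, hC.2.1, hC.2.2.trans (hn₁ n hn)⟩⟩

/-- `TCdWIRESae` is monotone in the depth. [folklore] -/
theorem TCdWIRESae_mono_depth {d d' : ℕ} (h : d ≤ d') (s : ℕ → ℕ) :
    TCdWIRESae d s ⊆ TCdWIRESae d' s :=
  FamilyAE_mono ⟨0, fun _ _ _ hC => ⟨hC.1, hC.2.1.trans h, hC.2.2⟩⟩

/-- The plain `AC_d[M]` class of Oliveira–Santhanam is contained in `AC_d[m][M]`. [folklore] -/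
theorem ACdSIZEae_subset_ACdModSIZEae (m d : ℕ) (M : ℕ → ℕ) :
    OliveiraSanthanam2018.ACdSIZEae d M ⊆ ACdModSIZEae m d M :=
  FamilyAE_mono ⟨0, fun _ _ _ hC => ⟨hC.1.mono Set.subset_union_left, hC.2.1, hC.2.2⟩⟩

/-- Non-vacuity (referee rule F1): `AC_d[m][M]` is inhabited for every `m, d, M` (`headLang`: the
projection `x₀`, no gates). [folklore] -/
theorem headLang_mem_ACdModSIZEae (m d : ℕ) (M : ℕ → ℕ) : headLang ∈ ACdModSIZEae m d M :=
  ACdSIZEae_subset_ACdModSIZEae m d M (OliveiraSanthanam2018.headLang_mem_ACdSIZEae d M)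

/-- Non-vacuity: `TC_d[s]` (wires) is inhabited for every `d, s`. [folklore] -/
theorem headLang_mem_TCdWIRESae (d : ℕ) (s : ℕ → ℕ) : headLang ∈ TCdWIRESae d s :=
  headLang_mem_FamilyAE ⟨0, fun n _ =>
    ⟨Circuit.isOver_input ltfBasis 0, by rw [OliveiraSanthanam2018.acDepth_input]; exact Nat.zero_le _,
      by rw [wires_input]; exact Nat.zero_le _⟩⟩

/-! ### Item 6: `AC_{d+2}[m][n^{1+ε}]`, `m` even -/

/-- Hypothesis of **Thm. 1.1 item 6** at `(m, d, ε)` (`C = NP`): for every `β ∈ (0,1)` some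
`2^{n^β}`-sparse `NP` language is outside `AC_{d+2}[m][⌈n^{1+ε}⌉]` (a.e., gates). OPEN — a `Prop`,
never asserted. [cite: ChenJinWilliams2019, Thm. 1.1 item 6 (hypothesis), TR19-118 p. 4] -/
def SparseNPACModHardAt (m d : ℕ) (ε : ℝ) : Prop :=
  ∀ β : ℝ, 0 < β → β < 1 →
    ∃ L : Language Bool, L ∈ NP ∧ IsSparse (expSparsity β) L ∧
      L ∉ ACdModSIZEae m (d + 2) (powCeil (1 + ε))

/-- "`NP ⊄ AC_d[m][n^k]` for all `k`": for every `k` some `NP` language is outside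
`ACdModSIZEae m d (n ↦ n^k)`. [cite: ChenJinWilliams2019, Thm. 1.1 item 6 (conclusion)] -/
def NPNotInACdMod (m d : ℕ) : Prop :=
  ∀ k : ℕ, ∃ L : Language Bool, L ∈ NP ∧ L ∉ ACdModSIZEae m d fun n => n ^ k

/-- **Chen–Jin–Williams 2019, Theorem 1.1 item 6 (`C = NP`).** Printed (TR19-118 p. 4): *"6. L_β ∉
AC_{d+2}[m][n^{1+ε}], then C ⊄ AC_d[m][n^k] for all k, for all constants d and even integers
m ≥ 2."* NO converse in print ("except for the last two"). Rendering: module docstring.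
[cite: ChenJinWilliams2019, Thm. 1.1 item 6, TR19-118 p. 4] -/
def thm11_item6_NP : Prop :=
  ∀ m : ℕ, Even m → 2 ≤ m → ∀ d : ℕ, ∀ ε : ℝ, 0 < ε → SparseNPACModHardAt m d ε → NPNotInACdMod m d

/-! ### Item 7: `TC_{d+O(log 1/ε)}[n^{1+ε}]`, wires -/

/-- The depth allowance "`d + O(log 1/ε)`" with the absolute constant made explicit:
`d + c₀·(⌈log₂(1/ε)⌉₊ + 1)`. [cite: ChenJinWilliams2019, Thm. 1.1 item 7 (parameters)] -/
def tcDepth (c₀ d : ℕ) (ε : ℝ) : ℕ := d + c₀ * (⌈Real.logb 2 (1 / ε)⌉₊ + 1)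

/-- The base depth is at most the allowed depth. [folklore] -/
theorem le_tcDepth (c₀ d : ℕ) (ε : ℝ) : d ≤ tcDepth c₀ d ε := Nat.le_add_right _ _

/-- Hypothesis of **Thm. 1.1 item 7** at `(c₀, d, ε)` (`C = NP`): for every `β ∈ (0,1)` some
`2^{n^β}`-sparse `NP` language is outside `TC_{d + c₀(⌈log₂ 1/ε⌉+1)}[⌈n^{1+ε}⌉]` (a.e., wires,
LTF gates). OPEN — a `Prop`, never asserted.
[cite: ChenJinWilliams2019, Thm. 1.1 item 7 (hypothesis), TR19-118 p. 4] -/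
def SparseNPTCHardAt (c₀ d : ℕ) (ε : ℝ) : Prop :=
  ∀ β : ℝ, 0 < β → β < 1 →
    ∃ L : Language Bool, L ∈ NP ∧ IsSparse (expSparsity β) L ∧
      L ∉ TCdWIRESae (tcDepth c₀ d ε) (powCeil (1 + ε))

/-- "`NP ⊄ TC_d[n^k]` for all `k`" (wires): for every `k` some `NP` language is outside
`TCdWIRESae d (n ↦ n^k)`. [cite: ChenJinWilliams2019, Thm. 1.1 item 7 (conclusion)] -/
def NPNotInTCd (d : ℕ) : Prop :=
  ∀ k : ℕ, ∃ L : Language Bool, L ∈ NP ∧ L ∉ TCdWIRESae d fun n => n ^ k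

/-- **Chen–Jin–Williams 2019, Theorem 1.1 item 7 (`C = NP`).** Printed (TR19-118 p. 4): *"7. L_β ∉
TC_{d+O(log 1/ε)}[n^{1+ε}], then C ⊄ TC_d[n^k] for all k, for all constants d."* NO converse in
print. The `O(·)` constant is absolute (it comes from the Chen–Tell code of Thm. 2.6, proof §4.1
p. 15: `d' = O(log 1/ε)`), hence `∃ c₀` outermost; `ε` ranges over `(0,1)`. Rendering: module
docstring. [cite: ChenJinWilliams2019, Thm. 1.1 item 7, TR19-118 p. 4] -/
def thm11_item7_NP : Prop :=
  ∃ c₀ : ℕ, ∀ d : ℕ, ∀ ε : ℝ, 0 < ε → ε < 1 → SparseNPTCHardAt c₀ d ε → NPNotInTCd d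

/-! ### API -/

/-- Consequence shape of item 6 for `AC⁰[6]`-type moduli: e.g. `m = 6`, any `d`.
[cite: ChenJinWilliams2019, Thm. 1.1 item 6] -/
theorem npNotInACdMod_six (h : thm11_item6_NP) (d : ℕ) {ε : ℝ} (hε : 0 < ε)
    (hH : SparseNPACModHardAt 6 d ε) : NPNotInACdMod 6 d :=
  h 6 ⟨3, rfl⟩ (by norm_num) d ε hε hH

/-- Consequence shape of item 7. [cite: ChenJinWilliams2019, Thm. 1.1 item 7] -/
theorem npNotInTCd_of_sparse (h : thm11_item7_NP) :
    ∃ c₀ : ℕ, ∀ d : ℕ, ∀ ε : ℝ, 0 < ε → ε < 1 → SparseNPTCHardAt c₀ d ε → NPNotInTCd d := h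

/-- The item-6 hypothesis is antitone in `ε`. [folklore] -/
theorem SparseNPACModHardAt.anti {m d : ℕ} {ε ε' : ℝ} (hε : 0 ≤ ε) (h : ε ≤ ε')
    (hH : SparseNPACModHardAt m d ε') : SparseNPACModHardAt m d ε := by
  intro β hβ hβ1
  obtain ⟨L, hNP, hsp, hL⟩ := hH β hβ hβ1
  exact ⟨L, hNP, hsp, fun hmem => hL (ACdModSIZEae_mono m (d + 2)
    ⟨0, fun n _ => powCeil_mono (by linarith) (by linarith) n⟩ hmem)⟩

/-- The item-6 hypothesis is antitone in the depth `d` (a deeper class is bigger). [folklore] -/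
theorem SparseNPACModHardAt.anti_depth {m d d' : ℕ} (h : d ≤ d') {ε : ℝ}
    (hH : SparseNPACModHardAt m d' ε) : SparseNPACModHardAt m d ε := by
  intro β hβ hβ1
  obtain ⟨L, hNP, hsp, hL⟩ := hH β hβ hβ1
  exact ⟨L, hNP, hsp, fun hmem => hL (ACdModSIZEae_mono_depth m (by omega) _ hmem)⟩

/-- The item-7 hypothesis at wire bound `⌈n^{1+ε}⌉` is antitone in the base depth `d`. [folklore] -/
theorem SparseNPTCHardAt.anti_depth {c₀ d d' : ℕ} (h : d ≤ d') {ε : ℝ}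
    (hH : SparseNPTCHardAt c₀ d' ε) : SparseNPTCHardAt c₀ d ε := by
  intro β hβ hβ1
  obtain ⟨L, hNP, hsp, hL⟩ := hH β hβ hβ1
  refine ⟨L, hNP, hsp, fun hmem => hL (TCdWIRESae_mono_depth ?_ _ hmem)⟩
  unfold tcDepth; omega

/-- The conclusions are monotone in depth the other way: `NP ⊄ TC_{d'}[n^k] ∀ k` implies
`NP ⊄ TC_d[n^k] ∀ k` for `d ≤ d'`. [folklore] -/
theorem NPNotInTCd.anti {d d' : ℕ} (h : d ≤ d') (hH : NPNotInTCd d') : NPNotInTCd d := by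
  intro k
  obtain ⟨L, hNP, hL⟩ := hH k
  exact ⟨L, hNP, fun hmem => hL (TCdWIRESae_mono_depth h _ hmem)⟩

/-- Likewise for `AC_d[m]`. [folklore] -/
theorem NPNotInACdMod.anti {m d d' : ℕ} (h : d ≤ d') (hH : NPNotInACdMod m d') :
    NPNotInACdMod m d := by
  intro k
  obtain ⟨L, hNP, hL⟩ := hH k
  exact ⟨L, hNP, fun hmem => hL (ACdModSIZEae_mono_depth m h _ hmem)⟩

end Literature.Computability.MetaComplexity.ChenJinWilliams2019
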